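import Summits.CriticalPhenomena.Ising3DConformalLimit.Theorems.MirrorHoelderCompactnessSeparableHoelderMirrors
import Literature.Probability.LatticeModels.ScalingLimit
import Literature.Probability.LatticeModels.HighDimPointwiseTriviality
import Literature.Probability.LatticeModels.CriticalTwoPointBounds
import HarnessLib

/-!
# Floor, scale and compactness bookkeeping for `SeparableHoelder` (route MirrorHoelderCompactness,
helper for item stmt-CriticalPhenomena-6151)

Elementary facts used to pass from a continuum configuration at mesh `δ` to its lattice
approximation `[x/δ] = latticeApprox δ x ∈ ℤ³` and back:

* coordinates versus the Euclidean norm in `ℝ³` (`abs_apply_le_norm`,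
  `exists_norm_le_two_mul_abs`);
* floors: `|⌊a⌋ - ⌊b⌋| ≤ |a - b| + 1`, the `ℓ¹` length of a lattice move
  (`l1Dist_latticeApprox_le`), a lower bound for lattice coordinate differences
  (`abs_sub_div_le_natAbs_add_one`), and the nine lattice level functions
  `V_k, V_k ± V_l` of `[v/δ]` against `⟪u, v⟫/δ`, `u = e_k, e_k ± e_l` (`level_latticeApprox`);
* the integer scales `q ≈ m/(64δ)`, `M ≈ m/(2δ)`, `R ≈ r₀/δ` of the Hölder estimate
  (`exists_scales`), positivity of the axis two-point function, `ρ★(δ)² = g(⌊1/δ⌋)⁻¹`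
  (`rhoStar_sq`) and the algebra of the rescaled square (`sq_bound_assemble`);
* a positive lower bound for the pair distances on a compact set of non-coincident configurations
  (`exists_pairSep`).

All `[folklore]`; no definitions are introduced.
-/

noncomputable section

open Finset Filter Set
open scoped BigOperators

namespace Summit.CriticalPhenomena.Ising3DConformalLimit.MirrorHoelderCompactnessSeparableHoelder

open Literature.Probability.LatticeModels

/-! ### Coordinates in `ℝ³` -/

/-- A coordinate is bounded by the Euclidean norm. [folklore] -/
theorem abs_apply_le_norm (v : EuclideanSpace ℝ (Fin 3)) (k : Fin 3) : |v k| ≤ ‖v‖ := by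
  refine abs_le_of_sq_le_sq ?_ (norm_nonneg v)
  rw [EuclideanSpace.real_norm_sq_eq]
  exact Finset.single_le_sum (f := fun i => (v i) ^ 2) (fun i _ => sq_nonneg (v i))
    (Finset.mem_univ k)

/-- Some coordinate carries half of the Euclidean norm in `ℝ³`. [folklore] -/
theorem exists_norm_le_two_mul_abs (v : EuclideanSpace ℝ (Fin 3)) :
    ∃ k : Fin 3, ‖v‖ ≤ 2 * |v k| := by
  by_contra h
  push Not at h
  have hsq : ∀ k, 4 * (v k) ^ 2 < ‖v‖ ^ 2 := fun k => by
    have h1 := h k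
    have h2 : 0 ≤ 2 * |v k| := by positivity
    have h3 : (2 * |v k|) ^ 2 < ‖v‖ ^ 2 := by gcongr
    calc 4 * (v k) ^ 2 = (2 * |v k|) ^ 2 := by rw [mul_pow, sq_abs]; norm_num
      _ < ‖v‖ ^ 2 := h3
  have hsum := EuclideanSpace.real_norm_sq_eq v
  rw [Fin.sum_univ_three] at hsum
  nlinarith [hsq 0, hsq 1, hsq 2]

/-! ### Lattice approximation at mesh `δ` -/

/-- `|⌊a⌋ - ⌊b⌋| ≤ |a - b| + 1`. [folklore] -/
theorem abs_floor_sub_floor_le (a b : ℝ) : |((⌊a⌋ - ⌊b⌋ : ℤ) : ℝ)| ≤ |a - b| + 1 := by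
  have ha1 := Int.floor_le a
  have ha2 := Int.lt_floor_add_one a
  have hb1 := Int.floor_le b
  have hb2 := Int.lt_floor_add_one b
  rw [Int.cast_sub, abs_le]
  constructor
  · have : -(|a - b|) ≤ a - b := neg_abs_le _
    linarith
  · have : a - b ≤ |a - b| := le_abs_self _
    linarith

/-- The `ℓ¹` distance of the lattice approximations of two points of `ℝ³` is at most
`3‖v - v'‖/δ + 3`. [folklore] -/
theorem l1Dist_latticeApprox_le {δ : ℝ} (hδ : 0 < δ) (v v' : EuclideanSpace ℝ (Fin 3)) :
    (Site.l1Dist (latticeApprox δ v) (latticeApprox δ v') : ℝ) ≤ 3 * (‖v - v'‖ / δ) + 3 := by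
  have hk : ∀ k : Fin 3,
      (((latticeApprox δ v k - latticeApprox δ v' k).natAbs : ℕ) : ℝ) ≤ ‖v - v'‖ / δ + 1 := by
    intro k
    rw [Nat.cast_natAbs, Int.cast_abs, latticeApprox_apply, latticeApprox_apply]
    refine (abs_floor_sub_floor_le _ _).trans ?_
    rw [← sub_div, abs_div, abs_of_pos hδ, ← PiLp.sub_apply]
    have := abs_apply_le_norm (v - v') k
    gcongr
  calc (Site.l1Dist (latticeApprox δ v) (latticeApprox δ v') : ℝ)
      = (((latticeApprox δ v 0 - latticeApprox δ v' 0).natAbs : ℕ) : ℝ) +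
          (((latticeApprox δ v 1 - latticeApprox δ v' 1).natAbs : ℕ) : ℝ) +
          (((latticeApprox δ v 2 - latticeApprox δ v' 2).natAbs : ℕ) : ℝ) := by
        unfold Site.l1Dist
        push_cast
        rw [Fin.sum_univ_three]
    _ ≤ (‖v - v'‖ / δ + 1) + (‖v - v'‖ / δ + 1) + (‖v - v'‖ / δ + 1) :=
        add_le_add (add_le_add (hk 0) (hk 1)) (hk 2)
    _ = 3 * (‖v - v'‖ / δ) + 3 := by ring

/-- A coordinate difference of the lattice approximations controls the continuum one from below:
`|v_k - v'_k|/δ ≤ |[v/δ]_k - [v'/δ]_k| + 1`. [folklore] -/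
theorem abs_sub_div_le_natAbs_add_one {δ : ℝ} (hδ : 0 < δ) (v v' : EuclideanSpace ℝ (Fin 3))
    (k : Fin 3) :
    |v k - v' k| / δ ≤ (((latticeApprox δ v k - latticeApprox δ v' k).natAbs : ℕ) : ℝ) + 1 := by
  rw [Nat.cast_natAbs, Int.cast_abs, latticeApprox_apply, latticeApprox_apply, Int.cast_sub]
  have ha1 := Int.floor_le (v k / δ)
  have ha2 := Int.lt_floor_add_one (v k / δ)
  have hb1 := Int.floor_le (v' k / δ)
  have hb2 := Int.lt_floor_add_one (v' k / δ)
  rw [show |v k - v' k| / δ = |v k / δ - v' k / δ| by rw [← sub_div, abs_div, abs_of_pos hδ]]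
  have h1 := le_abs_self ((⌊v k / δ⌋ : ℝ) - ⌊v' k / δ⌋)
  have h2 := neg_abs_le ((⌊v k / δ⌋ : ℝ) - ⌊v' k / δ⌋)
  rw [abs_sub_le_iff]
  constructor <;> linarith

/-- The nine lattice level functions `Ψ ∈ {V_k, V_k - V_l, V_k + V_l}` of the lattice
approximation approximate `⟪u, v⟫/δ` (`u = e_k, e_k - e_l, e_k + e_l`) within `2`. [folklore] -/
theorem level_latticeApprox (δ : ℝ) {u : EuclideanSpace ℝ (Fin 3)} {k l : Fin 3}
    (hu : u = EuclideanSpace.single k 1 ∨ u = EuclideanSpace.single k 1 + EuclideanSpace.single l 1 ∨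
      u = EuclideanSpace.single k 1 - EuclideanSpace.single l 1) :
    ∃ Ψ : Site 3 → ℤ, ((u = EuclideanSpace.single k 1 ∧ Ψ = fun V => V k) ∨
        (u = EuclideanSpace.single k 1 + EuclideanSpace.single l 1 ∧ Ψ = fun V => V k + V l) ∨
        (u = EuclideanSpace.single k 1 - EuclideanSpace.single l 1 ∧ Ψ = fun V => V k - V l)) ∧
      ∀ v : EuclideanSpace ℝ (Fin 3), |((Ψ (latticeApprox δ v) : ℤ) : ℝ) - inner ℝ u v / δ| ≤ 2 := by
  have hfl : ∀ (v : EuclideanSpace ℝ (Fin 3)) (q : Fin 3),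
      ((latticeApprox δ v q : ℤ) : ℝ) ≤ v q / δ ∧ v q / δ < (latticeApprox δ v q : ℝ) + 1 := fun v q => by
    rw [latticeApprox_apply]
    exact ⟨Int.floor_le _, Int.lt_floor_add_one _⟩
  rcases hu with rfl | rfl | rfl
  · refine ⟨fun V => V k, Or.inl ⟨rfl, rfl⟩, fun v => ?_⟩
    have h := hfl v k
    simp only [EuclideanSpace.inner_single_left, map_one, one_mul]
    rw [abs_le]
    constructor <;> linarith [h.1, h.2]
  · refine ⟨fun V => V k + V l, Or.inr (Or.inl ⟨rfl, rfl⟩), fun v => ?_⟩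
    have h := hfl v k
    have h' := hfl v l
    simp only [inner_add_left, EuclideanSpace.inner_single_left, map_one, one_mul, Int.cast_add,
      add_div]
    rw [abs_le]
    constructor <;> linarith [h.1, h.2, h'.1, h'.2]
  · refine ⟨fun V => V k - V l, Or.inr (Or.inr ⟨rfl, rfl⟩), fun v => ?_⟩
    have h := hfl v k
    have h' := hfl v l
    simp only [inner_sub_left, EuclideanSpace.inner_single_left, map_one, one_mul, Int.cast_sub,
      sub_div]
    rw [abs_le]
    constructor <;> linarith [h.1, h.2, h'.1, h'.2]

/-! ### Scales and rescaling -/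

/-- **The integer scales.** For `0 < δ ≤ min (m/128) (r₀/12)` and `r₀ ≤ m/2` there are integers
`q, M, R ≥ 1` with `m/(32δ) ≤ 4q`, `16q ≤ m/(4δ)`, `m/(2δ) - 1 < M ≤ m/(2δ)`,
`r₀/δ - 6 < R ≤ r₀/δ - 5` and `M + R + 5 ≤ m/δ` (`q = ⌊m/(64δ)⌋`, `M = ⌊m/(2δ)⌋`,
`R = ⌊r₀/δ⌋ - 5`). [folklore] -/
theorem exists_scales {m r₀ δ : ℝ} (hm : 0 < m) (hr₀ : 0 < r₀) (hr₀m : r₀ ≤ m / 2) (hδ0 : 0 < δ)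
    (hδm : δ ≤ m / 128) (hδr : δ ≤ r₀ / 12) :
    ∃ q M R : ℕ, 1 ≤ q ∧ m / δ / 32 ≤ 4 * (q : ℝ) ∧ 16 * (q : ℝ) ≤ m / δ / 4 ∧
      (M : ℝ) ≤ m / δ / 2 ∧ m / δ / 2 - 1 < M ∧
      1 ≤ R ∧ (R : ℝ) + 5 ≤ r₀ / δ ∧ r₀ / δ < R + 6 ∧ (M : ℝ) + R + 5 ≤ m / δ := by
  have ht : 128 ≤ m / δ := by rw [le_div_iff₀ hδ0]; linarith
  have hs : 12 ≤ r₀ / δ := by rw [le_div_iff₀ hδ0]; linarith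
  have hsm : r₀ / δ ≤ m / δ / 2 := by
    have h := div_le_div_of_nonneg_right hr₀m hδ0.le
    have e : m / 2 / δ = m / δ / 2 := by ring
    linarith
  -- `q`
  have hqle : ((⌊m / δ / 64⌋₊ : ℕ) : ℝ) ≤ m / δ / 64 := Nat.floor_le (by positivity)
  have hqgt : m / δ / 64 < ((⌊m / δ / 64⌋₊ : ℕ) : ℝ) + 1 := Nat.lt_floor_add_one _
  -- `M`
  have hMle : ((⌊m / δ / 2⌋₊ : ℕ) : ℝ) ≤ m / δ / 2 := Nat.floor_le (by positivity)
  have hMgt : m / δ / 2 < ((⌊m / δ / 2⌋₊ : ℕ) : ℝ) + 1 := Nat.lt_floor_add_one _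
  -- `R`
  have hF12 : 12 ≤ ⌊r₀ / δ⌋₊ := Nat.le_floor (by exact_mod_cast hs)
  have hFle : ((⌊r₀ / δ⌋₊ : ℕ) : ℝ) ≤ r₀ / δ := Nat.floor_le (by positivity)
  have hFgt : r₀ / δ < ((⌊r₀ / δ⌋₊ : ℕ) : ℝ) + 1 := Nat.lt_floor_add_one _
  have hRcast : (((⌊r₀ / δ⌋₊ - 5 : ℕ)) : ℝ) = ((⌊r₀ / δ⌋₊ : ℕ) : ℝ) - 5 := by
    rw [Nat.cast_sub (by omega)]; norm_num
  refine ⟨⌊m / δ / 64⌋₊, ⌊m / δ / 2⌋₊, ⌊r₀ / δ⌋₊ - 5, ?_, ?_, ?_, hMle, by linarith, by omega, ?_, ?_, ?_⟩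
  · have h : (1 : ℝ) < ((⌊m / δ / 64⌋₊ : ℕ) : ℝ) := by linarith
    exact_mod_cast h.le
  · linarith
  · linarith
  · rw [hRcast]; linarith
  · rw [hRcast]; linarith
  · rw [hRcast]; linarith

/-- The axis values of the critical two-point function are positive (`criticalTwoPoint_bounds_holds`).
[cite: DuminilCopin2019, Thm. 4.8] -/
theorem criticalTwoPoint_single_pos (t : ℕ) : 0 < criticalTwoPoint 3 (Pi.single 0 (t : ℤ)) := by
  by_cases ht : t = 0
  · subst ht
    simp only [Nat.cast_zero, Pi.single_zero]
    rw [criticalTwoPoint_zero']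
    exact one_pos
  · obtain ⟨c, C, hc, hb⟩ := criticalTwoPoint_bounds_holds (d := 3) le_rfl
    have hx : (Pi.single 0 (t : ℤ) : Site 3) ≠ 0 := by
      intro h
      have h0 := congr_fun h 0
      simp only [Pi.single_eq_same, Pi.zero_apply] at h0
      omega
    exact lt_of_lt_of_le (mul_pos hc (Real.rpow_pos_of_pos (norm_pos_iff.2 hx) _)) (hb _ hx).1

/-- `ρ★(δ)² = g(⌊1/δ⌋)⁻¹`. [folklore] -/
theorem rhoStar_sq (δ : ℝ) :
    ((criticalTwoPoint 3 (Pi.single 0 ⌊δ⁻¹⌋)) ^ (-(1 / 2 : ℝ))) ^ 2 =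
      (criticalTwoPoint 3 (Pi.single 0 ⌊δ⁻¹⌋))⁻¹ := by
  rw [← Real.rpow_natCast, ← Real.rpow_mul (criticalTwoPoint_nonneg' _)]
  norm_num
  exact Real.rpow_neg_one _

/-- Bookkeeping of the rescaled square: `g(N)^{-(n'+1)} D² ≤ 2·(2n')!·a·b^{n'}·c` from the
lattice bound `D² ≤ (2·(g(4q)/Q)·L)·((2n')!·g(R)^{n'})` and the three ratio bounds
`g(4q)/g(N) ≤ a`, `g(R)/g(N) ≤ b`, `L/Q ≤ c`. [folklore] -/
theorem sq_bound_assemble {D gq gN gR L Q fac a b c : ℝ} {n' : ℕ}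
    (hgN : 0 < gN) (hgq : 0 ≤ gq) (hgR : 0 ≤ gR) (hL : 0 ≤ L) (hQ : 0 < Q) (hfac : 0 ≤ fac)
    (hD : D ^ 2 ≤ (2 * (gq / Q) * L) * (fac * gR ^ n'))
    (ha : gq * gN⁻¹ ≤ a) (hb : gR * gN⁻¹ ≤ b) (hc : L / Q ≤ c) :
    gN⁻¹ ^ (n' + 1) * D ^ 2 ≤ 2 * fac * a * b ^ n' * c := by
  have hgN' : 0 < gN⁻¹ := inv_pos.2 hgN
  have e1 : 0 ≤ gq * gN⁻¹ := by positivity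
  have e2 : 0 ≤ gR * gN⁻¹ := by positivity
  have e3 : 0 ≤ L / Q := by positivity
  have e4 : (gR * gN⁻¹) ^ n' ≤ b ^ n' := pow_le_pow_left₀ e2 hb n'
  calc gN⁻¹ ^ (n' + 1) * D ^ 2 ≤ gN⁻¹ ^ (n' + 1) * ((2 * (gq / Q) * L) * (fac * gR ^ n')) :=
        mul_le_mul_of_nonneg_left hD (by positivity)
    _ = 2 * fac * (gq * gN⁻¹) * (gR * gN⁻¹) ^ n' * (L / Q) := by
        rw [pow_succ, mul_pow]
        field_simp
    _ ≤ 2 * fac * a * b ^ n' * c := by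
        have ha0 : 0 ≤ a := e1.trans ha
        have hb0 : 0 ≤ b := e2.trans hb
        have h1 : 2 * fac * (gq * gN⁻¹) ≤ 2 * fac * a := mul_le_mul_of_nonneg_left ha (by positivity)
        have h2 : 2 * fac * (gq * gN⁻¹) * (gR * gN⁻¹) ^ n' ≤ 2 * fac * a * b ^ n' :=
          mul_le_mul h1 e4 (by positivity) (by positivity)
        exact mul_le_mul h2 hc e3 (by positivity)

/-! ### Compact sets of non-coincident configurations -/

/-- On a compact set of non-coincident configurations the pair distances are bounded below by a
positive constant. [folklore] -/
theorem exists_pairSep {n' : ℕ} {K : Set (Fin (n' + 1) → EuclideanSpace ℝ (Fin 3))}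
    (hKs : K ⊆ NonCoincident 3 (n' + 1)) (hK : IsCompact K) :
    ∃ r : ℝ, 0 < r ∧ ∀ x ∈ K, ∀ j j', j ≠ j' → r ≤ ‖x j - x j'‖ := by
  have hp : ∀ p : Fin (n' + 1) × Fin (n' + 1), ∃ r : ℝ, 0 < r ∧
      ∀ x ∈ K, p.1 ≠ p.2 → r ≤ ‖x p.1 - x p.2‖ := by
    rintro ⟨j, j'⟩
    by_cases hjj' : j = j'
    · exact ⟨1, one_pos, fun x _ h => absurd hjj' h⟩
    rcases K.eq_empty_or_nonempty with hKe | hKne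
    · exact ⟨1, one_pos, fun x hx => by simp [hKe] at hx⟩
    have hcont : Continuous fun x : Fin (n' + 1) → EuclideanSpace ℝ (Fin 3) => ‖x j - x j'‖ :=
      ((continuous_apply j).sub (continuous_apply j')).norm
    obtain ⟨x₀, hx₀, hmin⟩ := hK.exists_isMinOn hKne hcont.continuousOn
    have hpos : 0 < ‖x₀ j - x₀ j'‖ := by
      rw [norm_pos_iff, sub_ne_zero]
      exact fun h => hjj' ((mem_nonCoincident x₀).1 (hKs hx₀) h)
    exact ⟨‖x₀ j - x₀ j'‖, hpos, fun x hx _ => hmin hx⟩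
  choose r hr hrK using hp
  refine ⟨Finset.univ.inf' Finset.univ_nonempty r, ?_, fun x hx j j' hjj' => ?_⟩
  · obtain ⟨p₀, -, hp₀⟩ := Finset.exists_mem_eq_inf' Finset.univ_nonempty r
    rw [hp₀]
    exact hr p₀
  · exact (Finset.inf'_le r (Finset.mem_univ (j, j'))).trans (hrK (j, j') x hx hjj')

end Summit.CriticalPhenomena.Ising3DConformalLimit.MirrorHoelderCompactnessSeparableHoelder

end
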